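import Summits.QuantumAdvantage.AdviceFreeQNC0.WalkCoreHub
import Summits.QuantumAdvantage.AdviceFreeQNC0.CubeTransfer
import HarnessLib

/-!
# Cell qa-qnc0 (rung F-Q1, route RingFrame, crux α): walk core — E6 CHARGE PROPAGATION and the
# charge equivalence `RingHardU → WalkHardAll` (planner qa-qnc0-p1 ROUND-9 §2 / Sketch10 §22.2, ask P9)

Statement VERBATIM from `Sketch10.lean` §22.2 (`ChargePropagation`) and PROVED:

* `ringWinU_charge_mod` — the win pattern depends on the charge only mod `3`;
* `card_mixedWinU_le_of_walkHard` — walk hardness at ONE charge `c₀` and degree `D + 1` on `ℓ ≥ 1`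
  bits bounds every EVEN mixed strategy of degree `D` at every charge `≡ c₀`: the triple pattern is
  a walk win pattern of degree `D + 1` (E4 `evenTriple_isWalkRow`) and `WIN` is linear
  (`ringWinU_xor`);
* **E6 `chargePropagation : ChargePropagation`** — localise on the window `[0, ℓ]` of `ℓ + q` bits
  (prover-3's `ringWinU_glue3_eq_mixedWinU` with empty prefix): the fibre over the last `q` bits `b`
  is a mixed game at charge `c + |b|` with an even outside triple, so every fibre with
  `c + |b| ≡ c₀ (mod 3)` has at most `θ·2^ℓ` wins;
* **`walkHardAll_of_ringHardU`** (Sketch10 `WalkHardAllOfRingHardU`, hypothesis = the body of the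
  route's `RingHardU`): the single charge `n + 2` at all large `n` and polylog degree gives EVERY
  charge, with `θ' = 1 − (1 − θ)/4` (`q = 3`: every residue class of `{0,1}³` has `≥ 2` elements).

With `WalkCoreHub` / `WalkCoreMixed` / `WalkCoreChain` and `ringHardU_of_walkHardAll`
(`Theorems/RingFrameRingToElimOfWalkCore.lean`):  `RingHardU ↔ WalkHardAll ↔ MixedHardPolylog ↔
LDMAFam ↔ LDMAWalk` — the walk core of `stub_LDMA` is EXACTLY `RingHardU`-equivalent, in the kernel.

WHAT THIS IS NOT: none of these equivalent hardness statements is proved; nothing on α or the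
separation.
-/

noncomputable section

namespace Summit.QuantumAdvantage.AdviceFreeQNC0

open Finset
open Literature.Computability.MetaComplexity Literature.Computability.MetaComplexity.Smolensky

/-! ### Vocabulary (verbatim from `Sketch10` §22.2) -/

/-- **E6 — CHARGE PROPAGATION**: hardness at ONE charge `c₀` at scale `ℓ` (degree `D + 1`) bounds
the wins at EVERY charge at scale `ℓ + q` (verbatim from `Sketch10` §22.2). -/
def ChargePropagation : Prop :=
  ∀ ℓ q D c₀ : ℕ, ∀ θ : ℝ, 1 ≤ ℓ →
    (∀ y : Fin (ℓ + 1) → (Fin ℓ → Bool) → Bool, (∀ g, HasDeg (y g) (D + 1)) →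
      ((univ.filter fun w : Fin ℓ → Bool => ringWinU c₀ y w = true).card : ℝ) ≤ θ * (2 : ℝ) ^ ℓ) →
    ∀ c : ℕ, ∀ y : Fin (ℓ + q + 1) → (Fin (ℓ + q) → Bool) → Bool, (∀ g, HasDeg (y g) D) →
      ((univ.filter fun u : Fin (ℓ + q) → Bool => ringWinU c y u = true).card : ℝ) ≤
        (2 : ℝ) ^ (ℓ + q) -
          (1 - θ) * (2 : ℝ) ^ ℓ *
            ((univ.filter fun b : Fin q → Bool => (c + wt b) % 3 = c₀ % 3).card : ℝ)

/-! ### The win pattern depends on the charge mod 3; mixed ≤ walk at one charge -/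

/-- `WIN` depends on the charge only mod `3`. -/
theorem ringWinU_charge_mod {n c c' : ℕ} (h : c % 3 = c' % 3) (y : Fin (n + 1) → (Fin n → Bool) → Bool)
    (w : Fin n → Bool) : ringWinU c y w = ringWinU c' y w := by
  unfold ringWinU
  have hs : (univ.filter fun g : Fin (n + 1) =>
        y g w = true ∧ (c + g.val + walkExp w g.val) % 3 ≠ 0) =
      univ.filter fun g : Fin (n + 1) => y g w = true ∧ (c' + g.val + walkExp w g.val) % 3 ≠ 0 :=
    Finset.filter_congr fun g _ => by
      have e : (c + g.val + walkExp w g.val) % 3 = (c' + g.val + walkExp w g.val) % 3 := by omega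
      rw [e]
  rw [hs]

/-- **Mixed ≤ walk at one charge**: walk hardness at charge `c₀`, degree `D + 1`, on `ℓ ≥ 1` bits
bounds every even mixed strategy of degree `D` at every charge `c' ≡ c₀ (mod 3)`. -/
theorem card_mixedWinU_le_of_walkHard {ℓ D c₀ c' : ℕ} {θ : ℝ} (hℓ : 1 ≤ ℓ)
    (H : ∀ y : Fin (ℓ + 1) → (Fin ℓ → Bool) → Bool, (∀ g, HasDeg (y g) (D + 1)) →
      ((univ.filter fun w : Fin ℓ → Bool => ringWinU c₀ y w = true).card : ℝ) ≤ θ * (2 : ℝ) ^ ℓ)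
    (hc : c' % 3 = c₀ % 3) (P : ℕ → (Fin ℓ → Bool) → Bool)
    (y : Fin (ℓ + 1) → (Fin ℓ → Bool) → Bool) (hP : ∀ r, HasDeg (P r) D)
    (hPeven : ∀ w, xor (P 0 w) (xor (P 1 w) (P 2 w)) = false) (hy : ∀ g, HasDeg (y g) D) :
    ((univ.filter fun w : Fin ℓ → Bool => mixedWinU c' P y w = true).card : ℝ) ≤ θ * (2 : ℝ) ^ ℓ := by
  obtain ⟨yP, hyP, hwin⟩ := evenTriple_isWalkRow ℓ hℓ c' D P ⟨hP, hPeven⟩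
  have e : (univ.filter fun w : Fin ℓ → Bool => mixedWinU c' P y w = true) =
      univ.filter fun w : Fin ℓ → Bool =>
        ringWinU c₀ (fun g w => xor (yP g w) (y g w)) w = true := by
    refine Finset.filter_congr fun w _ => ?_
    unfold mixedWinU
    have hw : P (wt w % 3) w = ringWinU c' yP w := hwin w
    rw [hw, ← ringWinU_xor, ringWinU_charge_mod hc]
  rw [e]
  exact H _ fun g => hasDeg_xor (hyP g) (hasDeg_of_le (hy g) (Nat.le_succ _))

/-! ### E6 in glued coordinates (empty prefix), then transported to `Fin (ℓ + q)` -/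

/-- E6 on `0 + ℓ + q` bits (window `[0, ℓ]`, empty prefix, suffix of `q` bits). -/
theorem chargePropagation_glue {ℓ q D c₀ : ℕ} {θ : ℝ} (hℓ : 1 ≤ ℓ)
    (H : ∀ y : Fin (ℓ + 1) → (Fin ℓ → Bool) → Bool, (∀ g, HasDeg (y g) (D + 1)) →
      ((univ.filter fun w : Fin ℓ → Bool => ringWinU c₀ y w = true).card : ℝ) ≤ θ * (2 : ℝ) ^ ℓ)
    (c : ℕ) (y : Fin (0 + ℓ + q + 1) → (Fin (0 + ℓ + q) → Bool) → Bool)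
    (hy : ∀ g, HasDeg (y g) D) :
    ((univ.filter fun u : Fin (0 + ℓ + q) → Bool => ringWinU c y u = true).card : ℝ) ≤
      (2 : ℝ) ^ ℓ * (2 : ℝ) ^ q -
        (1 - θ) * (2 : ℝ) ^ ℓ *
          ((univ.filter fun b : Fin q → Bool => (c + wt b) % 3 = c₀ % 3).card : ℝ) := by
  rw [card_filter_eq_sum_glue3 (fun u : Fin (0 + ℓ + q) → Bool => ringWinU c y u = true)]
  push_cast
  have hfib : ∀ (a : Fin 0 → Bool) (b : Fin q → Bool),
      ((univ.filter fun w : Fin ℓ → Bool => ringWinU c y (glue3 a w b) = true).card : ℝ) ≤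
        (2 : ℝ) ^ ℓ - (1 - θ) * (2 : ℝ) ^ ℓ * (if (c + wt b) % 3 = c₀ % 3 then 1 else 0) := by
    intro a b
    have heq : (univ.filter fun w : Fin ℓ → Bool => ringWinU c y (glue3 a w b) = true) =
        univ.filter fun w : Fin ℓ → Bool =>
          mixedWinU (inCharge c a b) (outParity y c a b) (inStrategy y a b) w = true :=
      Finset.filter_congr fun w _ => by rw [ringWinU_glue3_eq_mixedWinU]
    rw [heq]
    split_ifs with hb
    · have ha : wt a = 0 := by
        unfold wt
        rw [Finset.univ_eq_empty, Finset.filter_empty, Finset.card_empty]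
      have hch : inCharge c a b % 3 = c₀ % 3 := by unfold inCharge; omega
      have h := card_mixedWinU_le_of_walkHard hℓ H hch (outParity y c a b) (inStrategy y a b)
        (hasDeg_outParity c y hy a b) (outParity_even c y a b) (hasDeg_inStrategy y hy a b)
      linarith
    · have h : ((univ.filter fun w : Fin ℓ → Bool =>
          mixedWinU (inCharge c a b) (outParity y c a b) (inStrategy y a b) w = true).card : ℝ) ≤
          (2 : ℝ) ^ ℓ := by
        have h1 := Finset.card_le_univ (univ.filter fun w : Fin ℓ → Bool =>
          mixedWinU (inCharge c a b) (outParity y c a b) (inStrategy y a b) w = true)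
        rw [Fintype.card_fun, Fintype.card_bool, Fintype.card_fin] at h1
        exact_mod_cast h1
      linarith
  calc ∑ a : Fin 0 → Bool, ∑ b : Fin q → Bool,
        ((univ.filter fun w : Fin ℓ → Bool => ringWinU c y (glue3 a w b) = true).card : ℝ)
      ≤ ∑ _a : Fin 0 → Bool, ∑ b : Fin q → Bool,
          ((2 : ℝ) ^ ℓ - (1 - θ) * (2 : ℝ) ^ ℓ * (if (c + wt b) % 3 = c₀ % 3 then 1 else 0)) :=
        Finset.sum_le_sum fun a _ => Finset.sum_le_sum fun b _ => hfib a b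
    _ = ∑ b : Fin q → Bool,
          ((2 : ℝ) ^ ℓ - (1 - θ) * (2 : ℝ) ^ ℓ * (if (c + wt b) % 3 = c₀ % 3 then 1 else 0)) := by
        rw [Finset.sum_const, Finset.card_univ, Fintype.card_fun, Fintype.card_bool,
          Fintype.card_fin, pow_zero, one_smul]
    _ = (2 : ℝ) ^ ℓ * (2 : ℝ) ^ q -
          (1 - θ) * (2 : ℝ) ^ ℓ *
            ((univ.filter fun b : Fin q → Bool => (c + wt b) % 3 = c₀ % 3).card : ℝ) := by
        rw [Finset.sum_sub_distrib, Finset.sum_const, Finset.card_univ, Fintype.card_fun,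
          Fintype.card_bool, Fintype.card_fin, ← Finset.mul_sum, Finset.sum_boole, nsmul_eq_mul]
        push_cast
        ring

/-- transport of a strategy along `m' = m`. -/
def castStrategy {m m' : ℕ} (h : m' = m) (y : Fin (m + 1) → (Fin m → Bool) → Bool) :
    Fin (m' + 1) → (Fin m' → Bool) → Bool :=
  fun g u => y (Fin.cast (congrArg (· + 1) h) g) (fun i => u (Fin.cast h.symm i))

/-- the transported strategy has the same number of wins. -/
theorem card_ringWinU_castStrategy {m m' : ℕ} (h : m' = m) (c : ℕ)
    (y : Fin (m + 1) → (Fin m → Bool) → Bool) :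
    (univ.filter fun u : Fin m' → Bool => ringWinU c (castStrategy h y) u = true).card =
      (univ.filter fun u : Fin m → Bool => ringWinU c y u = true).card := by
  subst h
  rfl

/-- the transported strategy has the same degrees. -/
theorem hasDeg_castStrategy {m m' D : ℕ} (h : m' = m) (y : Fin (m + 1) → (Fin m → Bool) → Bool)
    (hy : ∀ g, HasDeg (y g) D) (g : Fin (m' + 1)) : HasDeg (castStrategy h y g) D := by
  subst h
  exact hy g

/-- **E6 `ChargePropagation`.** -/
theorem chargePropagation : ChargePropagation := by
  intro ℓ q D c₀ θ hℓ H c y hy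
  have h0 : 0 + ℓ + q = ℓ + q := by omega
  have main := chargePropagation_glue (q := q) hℓ H c (castStrategy h0 y) (hasDeg_castStrategy h0 y hy)
  rw [card_ringWinU_castStrategy h0 c y] at main
  rw [pow_add]
  exact main

/-! ### The charge equivalence: `RingHardU → WalkHardAll` -/

/-- Polylog bookkeeping: `(log₂ (ℓ + 3))^C + 1 ≤ (log₂ ℓ)^{2C+1}` for `ℓ ≥ 4`. -/
theorem log_pow_add_three_le {ℓ : ℕ} (hℓ : 4 ≤ ℓ) (C : ℕ) :
    (Nat.log 2 (ℓ + 3)) ^ C + 1 ≤ (Nat.log 2 ℓ) ^ (2 * C + 1) := by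
  have hlt : ℓ < 2 ^ (Nat.log 2 ℓ + 1) := Nat.lt_pow_succ_log_self (by norm_num) ℓ
  have h1 : Nat.log 2 (ℓ + 3) < Nat.log 2 ℓ + 2 :=
    Nat.log_lt_of_lt_pow (by omega) (by rw [pow_succ]; omega)
  have h2 : 2 ≤ Nat.log 2 ℓ := Nat.le_log_of_pow_le (by norm_num) (by omega)
  have h3 : Nat.log 2 (ℓ + 3) ≤ (Nat.log 2 ℓ) ^ 2 := by nlinarith
  calc (Nat.log 2 (ℓ + 3)) ^ C + 1 ≤ ((Nat.log 2 ℓ) ^ 2) ^ C + 1 :=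
        Nat.add_le_add_right (Nat.pow_le_pow_left h3 C) 1
    _ = (Nat.log 2 ℓ) ^ (2 * C) + 1 := by rw [← pow_mul]
    _ ≤ (Nat.log 2 ℓ) ^ (2 * C + 1) := log_pow_succ_le hℓ (2 * C)

/-- Every residue class of `{0,1}^q`, `q ≥ 3`, read through `b ↦ c + |b|`, has `≥ 2` elements. -/
theorem two_le_card_charge_class (q c c₀ : ℕ) (hq : 3 ≤ q) :
    (2 : ℝ) ≤ ((univ.filter fun b : Fin q → Bool => (c + wt b) % 3 = c₀ % 3).card : ℝ) := by
  have e : (univ.filter fun b : Fin q → Bool => (c + wt b) % 3 = c₀ % 3) = cls q (c₀ + 2 * c) :=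
    Finset.filter_congr fun b _ => by constructor <;> intro h <;> omega
  rw [e]
  have h := three_mul_card_cls_ge q (c₀ + 2 * c)
  have h8 : (8 : ℝ) ≤ (2 : ℝ) ^ q := by
    calc (8 : ℝ) = 2 ^ 3 := by norm_num
      _ ≤ 2 ^ q := pow_le_pow_right₀ (by norm_num) hq
  linarith

/-- **`RingHardU → WalkHardAll`** (Sketch10 `WalkHardAllOfRingHardU`; the hypothesis is the body of the
route's `RingHardU`, verbatim): the single charge `n + 2` gives every charge, `θ' = 1 − (1 − θ)/4`. -/
theorem walkHardAll_of_ringHardU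
    (h : ∃ θ : ℝ, θ < 1 ∧ ∀ C : ℕ, ∃ n₀ : ℕ, ∀ n ≥ n₀, ∀ y : Fin (n + 1) → (Fin n → Bool) → Bool,
      (∀ g, HasDeg (y g) ((Nat.log 2 n) ^ C)) →
        ((univ.filter fun u : Fin n → Bool => ringWinU (n + 2) y u = true).card : ℝ) ≤
          θ * (2 : ℝ) ^ n) :
    WalkHardAll := by
  obtain ⟨θ, hθ, hR⟩ := h
  refine ⟨1 - (1 - θ) / 4, by linarith, fun C => ?_⟩
  obtain ⟨n₀, hn₀⟩ := hR (2 * C + 1)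
  refine ⟨n₀ + 7, fun n hn c y hy => ?_⟩
  obtain ⟨ℓ, rfl⟩ : ∃ ℓ, n = ℓ + 3 := ⟨n - 3, by omega⟩
  have hℓ4 : 4 ≤ ℓ := by omega
  -- single-charge hardness on the window of `ℓ` bits at degree `D + 1`
  have H : ∀ y' : Fin (ℓ + 1) → (Fin ℓ → Bool) → Bool,
      (∀ g, HasDeg (y' g) ((Nat.log 2 (ℓ + 3)) ^ C + 1)) →
        ((univ.filter fun w : Fin ℓ → Bool => ringWinU (ℓ + 2) y' w = true).card : ℝ) ≤
          θ * (2 : ℝ) ^ ℓ :=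
    fun y' hy' => hn₀ ℓ (by omega) y' fun g => hasDeg_of_le (hy' g) (log_pow_add_three_le hℓ4 C)
  have main := chargePropagation ℓ 3 ((Nat.log 2 (ℓ + 3)) ^ C) (ℓ + 2) θ (by omega) H c y hy
  have hgood := two_le_card_charge_class 3 c (ℓ + 2) le_rfl
  have h1θ : 0 ≤ 1 - θ := by linarith
  have h2ℓ : (0 : ℝ) ≤ (2 : ℝ) ^ ℓ := by positivity
  have hpow : (2 : ℝ) ^ (ℓ + 3) = 8 * (2 : ℝ) ^ ℓ := by rw [pow_add]; norm_num; ring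
  calc ((univ.filter fun u : Fin (ℓ + 3) → Bool => ringWinU c y u = true).card : ℝ)
      ≤ (2 : ℝ) ^ (ℓ + 3) - (1 - θ) * (2 : ℝ) ^ ℓ *
          ((univ.filter fun b : Fin 3 → Bool => (c + wt b) % 3 = (ℓ + 2) % 3).card : ℝ) := main
    _ ≤ (2 : ℝ) ^ (ℓ + 3) - (1 - θ) * (2 : ℝ) ^ ℓ * 2 := by
        nlinarith [mul_nonneg h1θ h2ℓ]
    _ = (1 - (1 - θ) / 4) * (2 : ℝ) ^ (ℓ + 3) := by rw [hpow]; ring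

end Summit.QuantumAdvantage.AdviceFreeQNC0

end
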